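import Summits.ValiantsHypothesis.ValiantsHypothesis.Theses.SOSTau

/-!
# Crux `SOSTau.SOSTau` (stmt-ValiantsHypothesis-18748), line `Sketch`: stub A `stub_posOfRobustShallow`

Bookkeeping step of the line `Sketch` (idea `sparse-spijker-shallow-core`) for Dutta's SOS-τ conjecture.
For a real weighted sum of squares `F = Σᵢ aᵢ gᵢ²` with majorant `M = Σᵢ |aᵢ| gᵢ²` and support-sum
`S = Σᵢ |supp gᵢ|`, sort the distinct positive zeros `z₀ < z₁ < ⋯ < z_N` of `F` and split the `N`
excursions `[z_k, z_{k+1}]` into SHALLOW ones (`|F| ≤ M/2` on the whole closed interval) and ROBUST ones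
(some interior point `t` with `M(t)/2 < |F(t)|`; the point is interior because `F` vanishes and `M ≥ 0` at
the endpoints).  Hypothesis 1 bounds the robust indices by `C_R · S` for every representation; hypothesis 2
bounds the shallow indices by `C_Sh · S` for SUPPORT-MINIMAL representations of `F ≠ 0`.  Choosing a
support-minimal representation of the same polynomial (`Nat.find` on the set of attainable support-sums;
its support-sum `S*` satisfies `1 ≤ S* ≤ S` when `F ≠ 0`) gives
`#{positive distinct zeros} = N + 1 ≤ (C_R + C_Sh) · S* + 1 ≤ (C_R + C_Sh + 1) · S`.

No analytic input: pure finite bookkeeping over Mathlib (`Finset.orderEmbOfFin`, `Nat.find`,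
`Finset.card_filter_add_card_filter_not`, `Polynomial.mem_roots`).
-/

set_option linter.dupNamespace false

open Polynomial
open scoped BigOperators

namespace Summit.ValiantsHypothesis.ValiantsHypothesis.Theorems.SOSTauSOSTau

/-- The majorant `Σ |aᵢ| gᵢ²` is pointwise nonnegative. -/
theorem majorant_eval_nonneg {s : ℕ} (a : Fin s → ℝ) (g : Fin s → ℝ[X]) (t : ℝ) :
    0 ≤ (∑ i, Polynomial.C (|a i|) * g i ^ 2).eval t := by
  rw [Polynomial.eval_finsetSum]
  refine Finset.sum_nonneg fun i _ => ?_
  rw [Polynomial.eval_mul, Polynomial.eval_C, Polynomial.eval_pow]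
  positivity

/-- A representation `Σ aᵢ gᵢ²` of a NONZERO polynomial has support-sum at least `1`. -/
theorem one_le_supportSum {s : ℕ} (a : Fin s → ℝ) (g : Fin s → ℝ[X])
    (hF : (∑ i, Polynomial.C (a i) * g i ^ 2) ≠ 0) : 1 ≤ ∑ i, (g i).support.card := by
  by_contra h
  apply hF
  have h0 : ∑ i, (g i).support.card = 0 := by omega
  refine Finset.sum_eq_zero fun i _ => ?_
  have hi : (g i).support.card = 0 := Finset.sum_eq_zero_iff.mp h0 i (Finset.mem_univ i)
  rw [Finset.card_eq_zero, Polynomial.support_eq_empty] at hi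
  rw [hi, zero_pow two_ne_zero, mul_zero]

/-- Every representation `Σ aᵢ gᵢ²` admits a SUPPORT-MINIMAL representation of the same polynomial whose
support-sum is no larger (`Nat.find` on the attainable support-sums). -/
theorem exists_minimal_rep {s : ℕ} (a : Fin s → ℝ) (g : Fin s → ℝ[X]) :
    ∃ (s' : ℕ) (a' : Fin s' → ℝ) (g' : Fin s' → ℝ[X]),
      (∑ i, Polynomial.C (a' i) * g' i ^ 2) = (∑ i, Polynomial.C (a i) * g i ^ 2) ∧
      ∑ i, (g' i).support.card ≤ ∑ i, (g i).support.card ∧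
      ∀ (s'' : ℕ) (a'' : Fin s'' → ℝ) (g'' : Fin s'' → ℝ[X]),
        (∑ i, Polynomial.C (a'' i) * g'' i ^ 2) = (∑ i, Polynomial.C (a' i) * g' i ^ 2) →
          ∑ i, (g' i).support.card ≤ ∑ i, (g'' i).support.card := by
  classical
  have hP : ∃ w : ℕ, ∃ (s' : ℕ) (a' : Fin s' → ℝ) (g' : Fin s' → ℝ[X]),
      (∑ i, Polynomial.C (a' i) * g' i ^ 2) = (∑ i, Polynomial.C (a i) * g i ^ 2) ∧
        ∑ i, (g' i).support.card = w :=
    ⟨_, s, a, g, rfl, rfl⟩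
  obtain ⟨s', a', g', hF, hS⟩ := Nat.find_spec hP
  refine ⟨s', a', g', hF, ?_, fun s'' a'' g'' hF'' => ?_⟩
  · rw [hS]
    exact Nat.find_min' hP ⟨s, a, g, rfl, rfl⟩
  · rw [hS]
    exact Nat.find_min' hP ⟨s'', a'', g'', hF''.trans hF, rfl⟩

/-- **Core count (abstract form).** If `F ≠ 0`, `M ≥ 0` pointwise, every set of robust excursion indices
along positive zeros of `F` has at most `B_R` elements and every set of shallow ones at most `B_Sh`, then `F`
has at most `B_R + B_Sh + 1` distinct positive zeros: sort them as `z₀ < ⋯ < z_N` and split `Fin N`. -/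
theorem card_filter_pos_roots_le {F M : ℝ[X]} {BR BSh : ℕ} (hF : F ≠ 0) (hM : ∀ t, 0 ≤ M.eval t)
    (hR : ∀ (N : ℕ) (z : Fin (N + 1) → ℝ) (K : Finset (Fin N)), StrictMono z → 0 < z 0 →
      (∀ k, F.eval (z k) = 0) →
      (∀ k ∈ K, ∃ t : ℝ, z k.castSucc < t ∧ t < z k.succ ∧ 2⁻¹ * M.eval t < |F.eval t|) →
      K.card ≤ BR)
    (hSh : ∀ (N : ℕ) (z : Fin (N + 1) → ℝ) (K : Finset (Fin N)), StrictMono z → 0 < z 0 →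
      (∀ k, F.eval (z k) = 0) →
      (∀ k ∈ K, ∀ t : ℝ, z k.castSucc ≤ t → t ≤ z k.succ → |F.eval t| ≤ 2⁻¹ * M.eval t) →
      K.card ≤ BSh) :
    (F.roots.toFinset.filter (fun x => 0 < x)).card ≤ BR + BSh + 1 := by
  classical
  rcases hN : (F.roots.toFinset.filter (fun x => 0 < x)).card with _ | N
  · exact Nat.zero_le _
  -- the sorted positive distinct zeros `z₀ < z₁ < ⋯ < z_N`
  obtain ⟨z, hzmono, hzmem⟩ : ∃ z : Fin (N + 1) → ℝ, StrictMono z ∧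
      ∀ k, z k ∈ F.roots.toFinset.filter (fun x => 0 < x) :=
    ⟨_, (Finset.orderEmbOfFin _ hN).strictMono, Finset.orderEmbOfFin_mem _ hN⟩
  have hzpos : ∀ k, 0 < z k := fun k => (Finset.mem_filter.mp (hzmem k)).2
  have hzroot : ∀ k, F.eval (z k) = 0 := fun k => by
    have h := (Finset.mem_filter.mp (hzmem k)).1
    rw [Multiset.mem_toFinset, Polynomial.mem_roots hF] at h
    exact h
  -- shallow / robust dichotomy of the `N` excursions
  let Psh : Fin N → Prop := fun k =>
    ∀ t : ℝ, z k.castSucc ≤ t → t ≤ z k.succ → |F.eval t| ≤ 2⁻¹ * M.eval t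
  have hsum : (Finset.univ.filter Psh).card + (Finset.univ.filter fun k => ¬ Psh k).card = N := by
    rw [Finset.card_filter_add_card_filter_not, Finset.card_univ, Fintype.card_fin]
  have hrob : (Finset.univ.filter fun k => ¬ Psh k).card ≤ BR := by
    refine hR N z (Finset.univ.filter fun k => ¬ Psh k) hzmono (hzpos 0) hzroot fun k hk => ?_
    have hk' : ¬ Psh k := (Finset.mem_filter.mp hk).2
    obtain ⟨t, h1, h2, hlt⟩ :
        ∃ t : ℝ, z k.castSucc ≤ t ∧ t ≤ z k.succ ∧ 2⁻¹ * M.eval t < |F.eval t| := by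
      by_contra hcon
      exact hk' fun t h1 h2 => not_lt.mp fun hlt => hcon ⟨t, h1, h2, hlt⟩
    refine ⟨t, lt_of_le_of_ne h1 fun h => ?_, lt_of_le_of_ne h2 fun h => ?_, hlt⟩
    · subst h
      rw [hzroot, abs_zero] at hlt
      linarith [hM (z k.castSucc)]
    · subst h
      rw [hzroot, abs_zero] at hlt
      linarith [hM (z k.succ)]
  have hsh : (Finset.univ.filter Psh).card ≤ BSh :=
    hSh N z (Finset.univ.filter Psh) hzmono (hzpos 0) hzroot fun k hk => (Finset.mem_filter.mp hk).2
  omega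

/-- **Stub A** (`Stmt.robustCount → Stmt.shallowCount → Stmt.posCount` of the line `Sketch`): the robust
count (hypothesis 1) and the shallow count for support-minimal representations (hypothesis 2) bound the
number of distinct positive zeros of `Σ aᵢ gᵢ²` by `c · Σ |supp gᵢ|` with `c = C_R + C_Sh + 1`. -/
theorem stub_posOfRobustShallow :
    (∃ C : ℕ, ∀ (s : ℕ) (a : Fin s → ℝ) (g : Fin s → ℝ[X]) (N : ℕ) (z : Fin (N + 1) → ℝ)
      (K : Finset (Fin N)),
      StrictMono z → 0 < z 0 →
      (∀ k, (∑ i, Polynomial.C (a i) * g i ^ 2).eval (z k) = 0) →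
      (∀ k ∈ K, ∃ t : ℝ, z k.castSucc < t ∧ t < z k.succ ∧
        2⁻¹ * (∑ i, Polynomial.C (|a i|) * g i ^ 2).eval t < |(∑ i, Polynomial.C (a i) * g i ^ 2).eval t|) →
      K.card ≤ C * ∑ i, (g i).support.card) →
    (∃ C : ℕ, ∀ (s : ℕ) (a : Fin s → ℝ) (g : Fin s → ℝ[X]),
      (∀ (s' : ℕ) (a' : Fin s' → ℝ) (g' : Fin s' → ℝ[X]),
        (∑ i, Polynomial.C (a' i) * g' i ^ 2) = (∑ i, Polynomial.C (a i) * g i ^ 2) →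
          ∑ i, (g i).support.card ≤ ∑ i, (g' i).support.card) →
      ∀ (N : ℕ) (z : Fin (N + 1) → ℝ) (K : Finset (Fin N)),
      StrictMono z → 0 < z 0 → (∑ i, Polynomial.C (a i) * g i ^ 2) ≠ 0 →
      (∀ k, (∑ i, Polynomial.C (a i) * g i ^ 2).eval (z k) = 0) →
      (∀ k ∈ K, ∀ t : ℝ, z k.castSucc ≤ t → t ≤ z k.succ →
        |(∑ i, Polynomial.C (a i) * g i ^ 2).eval t| ≤ 2⁻¹ * (∑ i, Polynomial.C (|a i|) * g i ^ 2).eval t) →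
      K.card ≤ C * ∑ i, (g i).support.card) →
    ∃ c : ℕ, ∀ (s : ℕ) (a : Fin s → ℝ) (g : Fin s → ℝ[X]),
      ((∑ i, Polynomial.C (a i) * g i ^ 2).roots.toFinset.filter (fun x => 0 < x)).card ≤
        c * ∑ i, (g i).support.card := by
  rintro ⟨CR, hR⟩ ⟨CSh, hSh⟩
  refine ⟨CR + CSh + 1, fun s a g => ?_⟩
  by_cases hF : (∑ i, Polynomial.C (a i) * g i ^ 2) = 0
  · rw [hF, Polynomial.roots_zero]
    simp
  -- a support-minimal representation of the same polynomial
  obtain ⟨s', a', g', hFeq, hS, hmin⟩ := exists_minimal_rep a g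
  have hF' : (∑ i, Polynomial.C (a' i) * g' i ^ 2) ≠ 0 := by
    rw [hFeq]
    exact hF
  have hS1 : 1 ≤ ∑ i, (g' i).support.card := one_le_supportSum a' g' hF'
  have hcore := card_filter_pos_roots_le (BR := CR * ∑ i, (g' i).support.card)
    (BSh := CSh * ∑ i, (g' i).support.card) hF' (majorant_eval_nonneg a' g')
    (fun N z K hz h0 hroot hK => hR s' a' g' N z K hz h0 hroot hK)
    (fun N z K hz h0 hroot hK => hSh s' a' g' hmin N z K hz h0 hF' hroot hK)
  rw [hFeq] at hcore
  calc ((∑ i, Polynomial.C (a i) * g i ^ 2).roots.toFinset.filter (fun x => 0 < x)).card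
      ≤ CR * ∑ i, (g' i).support.card + CSh * ∑ i, (g' i).support.card + 1 := hcore
    _ ≤ CR * ∑ i, (g i).support.card + CSh * ∑ i, (g i).support.card +
          ∑ i, (g i).support.card :=
        add_le_add (add_le_add (Nat.mul_le_mul le_rfl hS) (Nat.mul_le_mul le_rfl hS)) (hS1.trans hS)
    _ = (CR + CSh + 1) * ∑ i, (g i).support.card := by ring

end Summit.ValiantsHypothesis.ValiantsHypothesis.Theorems.SOSTauSOSTau
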